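import Mathlib
import HarnessLib

/-!
# CurveCutCornerGame — decomp-res node «CurveCut» (lens-4 g35, critic row 199 BOOKED 0), tree file 3/3 of the node

Content VERBATIM from the decomp-res lens-4 g35 node `HOME/decomp-res-lens-4/g35/CurveCut.lean` (pin bedce505; no
carry, imports the landed tree only; namespace `…Theorems.HugValuationCut`); HOME = run/shared/lean/pub/decomp-res;
critic CRITIC-LEDGER row 199 BOOKED 0 (MAP (M-CurveLaw)); landing orders INBOX :1236 (08:49:13Z) — provenance,
critic text and the lens header in full in the first file of the node, `CurveCutKernels`.  `--kind proof --supports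
stmt-ResolutionOfSingularities-28338`.

## This file

§114 (g35 · NEW · KERNEL, DESK LAW TYPED — OUTSIDE CELL C BY LETTERS) THE CORNER-PAIR GAME OF A TWO-FACTOR DATUM
TERMINATES (`namespace CornerGame`, pure combinatorics over `Mathlib`): `CornerState` (exponents `(α, β; γ, δ)` of
`h ~ y^a + x^α u^β`, `K ~ (y^b, x^γ u^δ)`), `CornerState.Valid` (NEAR ∧ ISOLATED), the chart moves
`CornerState.moveX` / `moveU`, `IsCornerRun`, and THE LAW **`no_cornerRun`** (every `a`, `b`: no infinite
corner-pair run) — the combinatorial shadow of the C₃♮ alignment mechanism, honestly placed in the CONTACT column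
(31571), 0-priced in the lens-4 NP column.

[WRITER NOTE (decomp-res writer g13): file split only, at the node's own `══ FILE` markers (tree files ≤ 400 lines);
namespace, sections, section variables, the sub-namespaces `CornerGame` / `CornerGame.CornerState` and every
declaration exactly as in the lens (the node's HOME-only dupNamespace-linter line is dropped — the library sets it;
`noncomputable section` and the namespace-level `open` lines of the node are replayed in `CurveCutKernels` /
`CurveCutCells`; `CurveCutCornerGame` imports `Mathlib` + `HarnessLib` only, as the marker says, so it carries
neither — §114 names no tree declaration).]

(Sources: CossartPiltant2008 Prop. 4.4 (weighted-order chain law); Matsumura1987 Thms. 14.3, 17.8 (regular systems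
of parameters); Hironaka1964 Ch. III; Giraud1975; CossartJannsenSaito2020 Thm. 6.40, Ch. 8; Hauser2010Kangaroo;
HauserPerlega2019 §2; Kollar2007 3.58–3.60; StacksProject 00NQ / 0AFT.)
-/

namespace Summit.ResolutionOfSingularities.ResolutionOfSingularities.Theorems.HugValuationCut

namespace CornerGame

/-! ## ══ FILE 3/3 `Theorems/CurveCutCornerGame.lean` (§114; imports `Mathlib` + `HarnessLib` only) ══ -/

/-! ## §114 (g35 · NEW · KERNEL, DESK LAW TYPED — OUTSIDE CELL C BY LETTERS) THE CORNER-PAIR GAME OF A TWO-FACTOR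
DATUM TERMINATES

The ALIGNMENT MECHANISM of lane (NP-C) («the two factors `h`, `K` of an occult divisorial stalk `𝓘 = h·K` cannot both stay near
AND keep the marked point isolated for ever») in its tamest, MONOMIAL CORNER regime, typed as pure combinatorics.  DICTIONARY
(informal; the typed statement is the game): regular parameters `(y, x, u)` at `x_j`, `h = y^a + c·x^α u^β` (`c` a unit,
`α, β ≥ 0`), `K = (y^b, x^γ u^δ)`, `𝓘_j = h·K`, weight `n = a + b`.  The closed points of `Bl_{x_j}` NEAR for `𝓘` are near for
both factors (forcing, g33) and lie on the line `{y' = 0}` of the exceptional plane; at a translate point `x/u = t ≠ 0` of that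
line nearness of both factors makes the new exceptional line `{y' = u' = 0}` `a`-fold for `h'` and `b`-fold for `K'` (NOT
isolated); at the two origins the data keep their shape with exponents `moveX : (α, β; γ, δ) ↦ (α+β-a, β; γ+δ-b, δ)`,
`moveU : ↦ (α, α+β-a; γ, γ+δ-b)`; NEAR ⟺ `α+β ≥ a ∧ γ+δ ≥ b`; ISOLATED ⟹ neither coordinate axis is at once `a`-fold for `h` and
`b`-fold for `K` ⟺ `¬(α ≥ a ∧ γ ≥ b) ∧ ¬(β ≥ a ∧ δ ≥ b)`.  So every infinite forced tower that stays in the corner regime yields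
an infinite VALID RUN of the game (the game over-approximates such towers), and THE LAW `no_cornerRun` kills all runs.  HONEST
PLACEMENT: a corner-pair tower hugs the regular surface `{y = 0}` for ever (`RegularSurfaceHugging`, permanent contact) — it
lies in the CONTACT column (tree hypothesis 31571 `NoContactHuggingTowers`), NOT in the singular class, hence NOT in
CELL C: this
is the combinatorial SHADOW of the C₃♮ mechanism (there the contact surface must be re-chosen infinitely often — kangaroo — and
the alignment law has to survive re-preparations `y ↦ y + φ(x, u)`; no law on record), recorded as a typed desk law, 0-priced
in the lens-4 NP column.  Desk check: `HOME/decomp-res-lens-4/g35/desk/game3.py` (longest runs from the box `[0,10)⁴`: 9–13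
steps for `(a,b) ∈ {(2,2),…,(6,6)}`; no cycle). -/

/-- exponent state `(α, β; γ, δ)`: `h ~ y^a + x^α u^β`, `K ~ (y^b, x^γ u^δ)`. -/
structure CornerState where
  α : ℕ
  β : ℕ
  γ : ℕ
  δ : ℕ

namespace CornerState

/-- NEAR (both factors keep their orders `a`, `b`) and ISOLATED (neither axis is `a`-fold for `h` and `b`-fold for
`K` at once). -/
def Valid (a b : ℕ) (s : CornerState) : Prop :=
  a ≤ s.α + s.β ∧ b ≤ s.γ + s.δ ∧ ¬ (a ≤ s.α ∧ b ≤ s.γ) ∧ ¬ (a ≤ s.β ∧ b ≤ s.δ)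

/-- the origin of the `x`-chart. -/
def moveX (a b : ℕ) (s : CornerState) : CornerState := ⟨s.α + s.β - a, s.β, s.γ + s.δ - b, s.δ⟩

/-- the origin of the `u`-chart. -/
def moveU (a b : ℕ) (s : CornerState) : CornerState := ⟨s.α, s.α + s.β - a, s.γ, s.γ + s.δ - b⟩

end CornerState

/-- an infinite CORNER-PAIR RUN: every state valid, each the `x`- or `u`-origin of the previous. -/
def IsCornerRun (a b : ℕ) (s : ℕ → CornerState) : Prop :=
  ∀ j, (s j).Valid a b ∧ (s (j + 1) = (s j).moveX a b ∨ s (j + 1) = (s j).moveU a b)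

open CornerState in
/-- **THE CORNER-PAIR LAW (KERNEL, PROVED; every `a`, `b`): NO INFINITE CORNER-PAIR RUN** — the coupled exponent game of a
two-factor datum terminates.  PROOF: a factor shallow on both axes stays so and bleeds total degree (finite); otherwise each
factor is deep on some axis, isolation puts the deep axes of `h` and `K` OPPOSITE, the type (`h` deep on `x`, `K`
deep on `u`, or
the mirror) is preserved by both moves, and the ALIGNMENT POTENTIAL `Φ = deep(h) + deep(K)` drops at every step (the chart that
serves one factor taxes the other). [folklore] -/
theorem no_cornerRun (a b : ℕ) (s : ℕ → CornerState) : ¬ IsCornerRun a b s := by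
  intro h
  -- Step 1: a factor that is SHALLOW ON BOTH AXES stays so and loses total degree at every step: impossible in a run
  have hshH : ∀ j, ¬ ((s j).α < a ∧ (s j).β < a) := by
    intro j hj
    have key : ∀ t, (s (j + t)).α < a ∧ (s (j + t)).β < a ∧
        (s (j + t)).α + (s (j + t)).β + t ≤ (s j).α + (s j).β := by
      intro t
      induction t with
      | zero => exact ⟨hj.1, hj.2, by simp⟩
      | succ t ih =>
        obtain ⟨hv, hm⟩ := h (j + t)
        rw [show j + (t + 1) = j + t + 1 from rfl]
        rcases hm with hm | hm <;>
          · rw [hm]; simp only [Valid, moveX, moveU] at hv ⊢; omega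
    obtain ⟨hv, -⟩ := h (j + ((s j).α + (s j).β + 1))
    have hk := key ((s j).α + (s j).β + 1)
    simp only [Valid] at hv
    omega
  have hshK : ∀ j, ¬ ((s j).γ < b ∧ (s j).δ < b) := by
    intro j hj
    have key : ∀ t, (s (j + t)).γ < b ∧ (s (j + t)).δ < b ∧
        (s (j + t)).γ + (s (j + t)).δ + t ≤ (s j).γ + (s j).δ := by
      intro t
      induction t with
      | zero => exact ⟨hj.1, hj.2, by simp⟩
      | succ t ih =>
        obtain ⟨hv, hm⟩ := h (j + t)
        rw [show j + (t + 1) = j + t + 1 from rfl]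
        rcases hm with hm | hm <;>
          · rw [hm]; simp only [Valid, moveX, moveU] at hv ⊢; omega
    obtain ⟨hv, -⟩ := h (j + ((s j).γ + (s j).δ + 1))
    have hk := key ((s j).γ + (s j).δ + 1)
    simp only [Valid] at hv
    omega
  -- Step 2: the ALIGNMENT POTENTIAL `Φ = (the deep exponent of h) + (the deep exponent of K)` drops at every step
  let Φ : ℕ → ℕ := fun j =>
    (if a ≤ (s j).α then (s j).α else (s j).β) + (if b ≤ (s j).γ then (s j).γ else (s j).δ)
  have hdec : ∀ j, Φ (j + 1) < Φ j := by
    intro j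
    obtain ⟨hv, hm⟩ := h j
    obtain ⟨hv', -⟩ := h (j + 1)
    have h1 := hshH j; have h2 := hshK j; have h1' := hshH (j + 1); have h2' := hshK (j + 1)
    simp only [Φ]
    rcases hm with hm | hm <;>
      · rw [hm] at hv' h1' h2' ⊢; simp only [Valid, moveX, moveU] at hv hv' h1 h2 h1' h2' ⊢; split_ifs <;> omega
  have hle : ∀ j, Φ j + j ≤ Φ 0 := by
    intro j
    induction j with
    | zero => simp
    | succ j ih => have := hdec j; omega
  have := hle (Φ 0 + 1)
  omega

end CornerGame

end Summit.ResolutionOfSingularities.ResolutionOfSingularities.Theorems.HugValuationCut
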